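import Mathlib
import HarnessLib
import Summits.ResolutionOfSingularities.ResolutionOfSingularities.Theorems.WildQuotientsWildQuotientResolutionS1aGraphRootData

/-!
# S1a — R4e: the ring-level data of the graph root over `L = k[x][1/hh]` AT A COMMON DEGREE `dbar` (`graphRoot_ringData'`)

[OURS · L1 W4.5c · lead-1 g17; plan-1 RULING R-F15s ★ R4e-rational `graphTail_killsIn_two` — ✓`exists_moveAtlas_of_nodes` wants ONE blow-up degree `d·k` for ALL
critical points, so the per-point ring package of ✓`…S1aGraphRootData` (degree `D·(m+2)(m+1)p`, depending on `m = mᵢ`) is restated at an ARBITRARY degree `dbar` with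
`dbar = (m+2)·n₀ = p·n₁ = (m+1)p·n₂`: the 3-cover `(x₀^{n₀}, N(x₁)^{n₁}, N(t)^{n₂})`, its `σ`-fixedness, the cover elements in `R^w`, `t̂ ∣ c₂`, `hrad`, and the
residual sections killing the charts of `x₀` and of the tail norm; same proof] — NOT statements of the manuscript; counted 0; AI-level work, weaker than expert review.
Crux stmt-ResolutionOfSingularities-17941 `CyclicQuotientFourfolds`, line `s1a-logminvertex` v13 (`stub_reachLowerInFX`).

* ★★ `graphRoot_ringData'` — the package at degree `dbar`.
-/

set_option linter.dupNamespace false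

noncomputable section

open Literature.AlgebraicGeometry.Resolution
open scoped LaurentPolynomial
open MvPolynomial
open Summit.ResolutionOfSingularities.ResolutionOfSingularities.Theorems.WildQuotientResolution.S1
open Summit.ResolutionOfSingularities.ResolutionOfSingularities.Theorems.WildQuotientResolution.S1.CoarseChart
open Summit.ResolutionOfSingularities.ResolutionOfSingularities.Theorems.WildQuotientResolution.S1.NodeAway
open Summit.ResolutionOfSingularities.ResolutionOfSingularities.Theorems.WildQuotientResolution.S1.CentreAway
open Summit.ResolutionOfSingularities.ResolutionOfSingularities.Theorems.WildQuotientResolution.S1.BlowupCharts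
open Summit.ResolutionOfSingularities.ResolutionOfSingularities.Theorems.WildQuotientResolution.S1.GameFrame.GModel

namespace Summit.ResolutionOfSingularities.ResolutionOfSingularities.Theorems.WildQuotientResolution.S1.KillCert.QhAway

variable {k : Type} [Field k] (σ : MvPolynomial (Fin 4) k ≃+* MvPolynomial (Fin 4) k) (hC : ∀ a : k, σ (C a) = C a)
  (h0 : σ (X 0) = X 0) (h1 : σ (X 1) = X 1 + X 0) (h2 : σ (X 2) = X 2) (m : ℕ) (wl : Polynomial k)
  (h3 : σ (X 3) = X 3 + (X 2 - X 1 ^ (m + 1) * Polynomial.aeval (X 1 : MvPolynomial (Fin 4) k) wl : MvPolynomial (Fin 4) k))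
  (hh : MvPolynomial (Fin 4) k) (hσh : σ hh = hh)
  {p : ℕ} (hp : 0 < p) (hσpL : ∀ y : (Localization.Away hh), (⇑(sigmaAway σ hσh))^[p] y = y)
  (hσJ : ∀ n : ℕ, ((weightedFiltration (fun i => algebraMap (MvPolynomial (Fin 4) k) (Localization.Away hh) (X ((![0, 1, 2] : Fin 3 → Fin 4) i))) (![m + 2, 1, m + 1] : Fin 3 → ℕ)).ideal n).map ((sigmaAway σ hσh) : (Localization.Away hh) →+* (Localization.Away hh)) ≤ (weightedFiltration (fun i => algebraMap (MvPolynomial (Fin 4) k) (Localization.Away hh) (X ((![0, 1, 2] : Fin 3 → Fin 4) i))) (![m + 2, 1, m + 1] : Fin 3 → ℕ)).ideal n)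
  (ht : (algebraMap (MvPolynomial (Fin 4) k) (Localization.Away hh) (X 2 - X 1 ^ (m + 1) * Polynomial.aeval (X 1 : MvPolynomial (Fin 4) k) wl : MvPolynomial (Fin 4) k)) ∈ (weightedFiltration (fun i => algebraMap (MvPolynomial (Fin 4) k) (Localization.Away hh) (X ((![0, 1, 2] : Fin 3 → Fin 4) i))) (![m + 2, 1, m + 1] : Fin 3 → ℕ)).ideal (m + 1))

section Data

variable {mg : ℕ} (mo : Fin mg → ℕ) (𝒜 : (Π j : Fin mg, ZMod (mo j)) → AddSubgroup (Localization.Away hh)) [GradedRing 𝒜] (h𝒜 : ∀ x : (Localization.Away hh), x ∈ 𝒜 0)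
  (hσp : ∀ a : MvPolynomial (Fin 4) k, (⇑σ)^[p] a = a) (hh0 : hh ≠ 0)

set_option maxHeartbeats 4000000 in
include h0 h1 h2 h3 hσp hh0 h𝒜 in
/-- ★★ **THE RING-LEVEL DATA OF THE GRAPH ROOT OVER `L` AT AN ARBITRARY COMMON DEGREE** `dbar = (m+2)n₀ = p·n₁ = (m+1)p·n₂` (generalises ✓`graphRoot_ringData`, whose `dbar = D·(m+2)(m+1)p` cannot be made uniform over several critical points): the 3-cover `y = (x₀^{(m+1)pD}, N(x₁)^{(m+2)(m+1)D},
N(t)^{(m+2)D})`, its trace membership and `σ`-fixedness, the cover elements `c₀ = u₀′^{n₀}`, `c₁ = (∏ᵢ(u₁′ + i·u₀′s^{m+1}))^{n₁}`, `t̂ ∣ c₂`, `hrad`, and on EVERY chart `j`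
the two residual sections `u₀′^{n₀}/cⱼ`, `c₂/cⱼ` (degree 0, in `𝔞·R_{cⱼ}`, `𝔞 = (aug σ_R : s^{m+1})`). [OURS · L1 W4.5c · R4e; NOT a statement of the manuscript] -/
theorem graphRoot_ringData' [Fact p.Prime] [CharP k p] (dbar n₀ n₁ n₂ : ℕ) (hn₀ : 0 < n₀) (hn₁ : 0 < n₁) (hn₂ : 0 < n₂)
    (hd₀' : dbar = (m + 2) * n₀) (hd₁' : dbar = p * n₁) (hd₂' : dbar = (m + 1) * p * n₂) :
    ∃ (y : Fin 3 → ↥(𝒜 0)) (hy : ∀ j, y j ∈ (traceFiltration 𝒜 (fun i => algebraMap (MvPolynomial (Fin 4) k) (Localization.Away hh) (X ((![0, 1, 2] : Fin 3 → Fin 4) i))) (![m + 2, 1, m + 1] : Fin 3 → ℕ)).ideal dbar),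
      (∀ j, (sigmaAway σ hσh) (y j : (Localization.Away hh)) = y j) ∧
      ((y 0 : (Localization.Away hh)) = (fun i => algebraMap (MvPolynomial (Fin 4) k) (Localization.Away hh) (X ((![0, 1, 2] : Fin 3 → Fin 4) i))) 0 ^ n₀) ∧
      ((y 1 : (Localization.Away hh)) = (∏ i : ZMod p, ((fun i => algebraMap (MvPolynomial (Fin 4) k) (Localization.Away hh) (X ((![0, 1, 2] : Fin 3 → Fin 4) i))) 1 + (i.val : (Localization.Away hh)) * (fun i => algebraMap (MvPolynomial (Fin 4) k) (Localization.Away hh) (X ((![0, 1, 2] : Fin 3 → Fin 4) i))) 0)) ^ n₁) ∧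
      ((y 2 : (Localization.Away hh)) = (∏ j : ZMod p, (⇑(sigmaAway σ hσh))^[j.val] (algebraMap (MvPolynomial (Fin 4) k) (Localization.Away hh) (X 2 - X 1 ^ (m + 1) * Polynomial.aeval (X 1 : MvPolynomial (Fin 4) k) wl : MvPolynomial (Fin 4) k))) ^ n₂) ∧
      coverElement 𝒜 (fun i => algebraMap (MvPolynomial (Fin 4) k) (Localization.Away hh) (X ((![0, 1, 2] : Fin 3 → Fin 4) i))) (![m + 2, 1, m + 1] : Fin 3 → ℕ) dbar (y 0) (hy 0) = cobordantAlgebra.u' (fun i => algebraMap (MvPolynomial (Fin 4) k) (Localization.Away hh) (X ((![0, 1, 2] : Fin 3 → Fin 4) i))) (![m + 2, 1, m + 1] : Fin 3 → ℕ) 0 ^ n₀ ∧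
      coverElement 𝒜 (fun i => algebraMap (MvPolynomial (Fin 4) k) (Localization.Away hh) (X ((![0, 1, 2] : Fin 3 → Fin 4) i))) (![m + 2, 1, m + 1] : Fin 3 → ℕ) dbar (y 1) (hy 1) = (∏ i : ZMod p, (cobordantAlgebra.u' (fun i => algebraMap (MvPolynomial (Fin 4) k) (Localization.Away hh) (X ((![0, 1, 2] : Fin 3 → Fin 4) i))) (![m + 2, 1, m + 1] : Fin 3 → ℕ) 1 + algebraMap (Localization.Away hh) ↥(cobordantAlgebra (fun i => algebraMap (MvPolynomial (Fin 4) k) (Localization.Away hh) (X ((![0, 1, 2] : Fin 3 → Fin 4) i))) (![m + 2, 1, m + 1] : Fin 3 → ℕ)) (i.val : (Localization.Away hh)) * (cobordantAlgebra.u' (fun i => algebraMap (MvPolynomial (Fin 4) k) (Localization.Away hh) (X ((![0, 1, 2] : Fin 3 → Fin 4) i))) (![m + 2, 1, m + 1] : Fin 3 → ℕ) 0 * cobordantAlgebra.s (fun i => algebraMap (MvPolynomial (Fin 4) k) (Localization.Away hh) (X ((![0, 1, 2] : Fin 3 → Fin 4) i))) (![m + 2, 1, m + 1] : Fin 3 →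 ℕ) ^ (m + 1)))) ^ n₁ ∧
      ((⟨_, C_mul_T_mem_cobordantAlgebra _ _ ht⟩ : ↥(cobordantAlgebra (fun i => algebraMap (MvPolynomial (Fin 4) k) (Localization.Away hh) (X ((![0, 1, 2] : Fin 3 → Fin 4) i))) (![m + 2, 1, m + 1] : Fin 3 → ℕ))) ∣ coverElement 𝒜 (fun i => algebraMap (MvPolynomial (Fin 4) k) (Localization.Away hh) (X ((![0, 1, 2] : Fin 3 → Fin 4) i))) (![m + 2, 1, m + 1] : Fin 3 → ℕ) dbar (y 2) (hy 2)) ∧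
      (∀ l : Fin 3, cobordantAlgebra.u' (fun i => algebraMap (MvPolynomial (Fin 4) k) (Localization.Away hh) (X ((![0, 1, 2] : Fin 3 → Fin 4) i))) (![m + 2, 1, m + 1] : Fin 3 → ℕ) l ∈ (Ideal.span (Set.range fun j => coverElement 𝒜 (fun i => algebraMap (MvPolynomial (Fin 4) k) (Localization.Away hh) (X ((![0, 1, 2] : Fin 3 → Fin 4) i))) (![m + 2, 1, m + 1] : Fin 3 → ℕ) dbar (y j) (hy j))).radical) ∧
      (∀ j : Fin 3,
        (algebraMap ↥(cobordantAlgebra (fun i => algebraMap (MvPolynomial (Fin 4) k) (Localization.Away hh) (X ((![0, 1, 2] : Fin 3 → Fin 4) i))) (![m + 2, 1, m + 1] : Fin 3 → ℕ)) (ChartRing 𝒜 (fun i => algebraMap (MvPolynomial (Fin 4) k) (Localization.Away hh) (X ((![0, 1, 2] : Fin 3 → Fin 4) i))) (![m + 2, 1, m + 1] : Fin 3 → ℕ) dbar (y j) (hy j)) (cobordantAlgebra.u' (fun i => algebraMap (MvPolynomial (Fin 4) k) (Localization.Away hh) (X ((![0, 1, 2] : Fin 3 → Fin 4) i))) (![m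 + 2, 1, m + 1] : Fin 3 → ℕ) 0 ^ n₀) * IsLocalization.Away.invSelf (coverElement 𝒜 (fun i => algebraMap (MvPolynomial (Fin 4) k) (Localization.Away hh) (X ((![0, 1, 2] : Fin 3 → Fin 4) i))) (![m + 2, 1, m + 1] : Fin 3 → ℕ) dbar (y j) (hy j)) ∈
            chartNodeGrading mo 𝒜 (fun i => algebraMap (MvPolynomial (Fin 4) k) (Localization.Away hh) (X ((![0, 1, 2] : Fin 3 → Fin 4) i))) (![m + 2, 1, m + 1] : Fin 3 → ℕ) (fun _ => h𝒜 _) (dbar) (y j) (hy j) 0 ∧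
          algebraMap ↥(cobordantAlgebra (fun i => algebraMap (MvPolynomial (Fin 4) k) (Localization.Away hh) (X ((![0, 1, 2] : Fin 3 → Fin 4) i))) (![m + 2, 1, m + 1] : Fin 3 → ℕ)) (ChartRing 𝒜 (fun i => algebraMap (MvPolynomial (Fin 4) k) (Localization.Away hh) (X ((![0, 1, 2] : Fin 3 → Fin 4) i))) (![m + 2, 1, m + 1] : Fin 3 → ℕ) dbar (y j) (hy j)) (cobordantAlgebra.u' (fun i => algebraMap (MvPolynomial (Fin 4) k) (Localization.Away hh) (X ((![0, 1, 2] : Fin 3 → Fin 4) i))) (![m + 2, 1, m + 1] : Fin 3 → ℕ) 0 ^ n₀) * IsLocalization.Away.invSelf (coverElement 𝒜 (fun i => algebraMap (MvPolynomial (Fin 4) k) (Localization.Away hh) (X ((![0, 1, 2] : Fin 3 → Fin 4) i))) (![m + 2, 1, m + 1] : Fin 3 → ℕ) dbar (y j) (hy j)) ∈ (((augmentationIdeal (sigmaR (sigmaAway σ hσh) (fun i => algebraMap (MvPolynomial (Fin 4) k) (Localization.Away hh) (X ((![0, 1, 2] : Fin 3 → Fin 4) i))) (![m + 2, 1, m +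 1] : Fin 3 → ℕ) hσJ hp hσpL)).colon (Ideal.span {cobordantAlgebra.s (fun i => algebraMap (MvPolynomial (Fin 4) k) (Localization.Away hh) (X ((![0, 1, 2] : Fin 3 → Fin 4) i))) (![m + 2, 1, m + 1] : Fin 3 → ℕ) ^ (m + 1)}))).map (algebraMap ↥(cobordantAlgebra (fun i => algebraMap (MvPolynomial (Fin 4) k) (Localization.Away hh) (X ((![0, 1, 2] : Fin 3 → Fin 4) i))) (![m + 2, 1, m + 1] : Fin 3 → ℕ)) (ChartRing 𝒜 (fun i => algebraMap (MvPolynomial (Fin 4) k) (Localization.Away hh) (X ((![0, 1, 2] : Fin 3 → Fin 4) i))) (![m + 2, 1, m + 1] : Fin 3 → ℕ) dbar (y j) (hy j)))) ∧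
        (algebraMap ↥(cobordantAlgebra (fun i => algebraMap (MvPolynomial (Fin 4) k) (Localization.Away hh) (X ((![0, 1, 2] : Fin 3 → Fin 4) i))) (![m + 2, 1, m + 1] : Fin 3 → ℕ)) (ChartRing 𝒜 (fun i => algebraMap (MvPolynomial (Fin 4) k) (Localization.Away hh) (X ((![0, 1, 2] : Fin 3 → Fin 4) i))) (![m + 2, 1, m + 1] : Fin 3 → ℕ) dbar (y j) (hy j)) (coverElement 𝒜 (fun i => algebraMap (MvPolynomial (Fin 4) k) (Localization.Away hh) (X ((![0, 1, 2] : Fin 3 → Fin 4) i))) (![m + 2, 1, m + 1] : Fin 3 → ℕ) dbar (y 2) (hy 2)) * IsLocalization.Away.invSelf (coverElement 𝒜 (fun i => algebraMap (MvPolynomial (Fin 4) k) (Localization.Away hh) (X ((![0, 1, 2] : Fin 3 → Fin 4) i))) (![m + 2, 1, m + 1] : Fin 3 → ℕ) dbar (y j) (hy j)) ∈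
            chartNodeGrading mo 𝒜 (fun i => algebraMap (MvPolynomial (Fin 4) k) (Localization.Away hh) (X ((![0, 1, 2] : Fin 3 → Fin 4) i))) (![m + 2, 1, m + 1] : Fin 3 → ℕ) (fun _ => h𝒜 _) (dbar) (y j) (hy j) 0 ∧
          algebraMap ↥(cobordantAlgebra (fun i => algebraMap (MvPolynomial (Fin 4) k) (Localization.Away hh) (X ((![0, 1, 2] : Fin 3 → Fin 4) i))) (![m + 2, 1, m + 1] : Fin 3 → ℕ)) (ChartRing 𝒜 (fun i => algebraMap (MvPolynomial (Fin 4) k) (Localization.Away hh) (X ((![0, 1, 2] : Fin 3 → Fin 4) i))) (![m + 2, 1, m + 1] : Fin 3 → ℕ) dbar (y j) (hy j)) (coverElement 𝒜 (fun i => algebraMap (MvPolynomial (Fin 4) k) (Localization.Away hh) (X ((![0, 1, 2] : Fin 3 → Fin 4) i))) (![m + 2, 1, m + 1] : Fin 3 → ℕ) dbar (y 2) (hy 2)) * IsLocalization.Away.invSelf (coverElement 𝒜 (fun i => algebraMap (MvPolynomial (Fin 4) k) (Localization.Away hh) (X ((![0, 1, 2] : Fin 3 → Fin 4) i))) (![m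 + 2, 1, m + 1] : Fin 3 → ℕ) dbar (y j) (hy j)) ∈ (((augmentationIdeal (sigmaR (sigmaAway σ hσh) (fun i => algebraMap (MvPolynomial (Fin 4) k) (Localization.Away hh) (X ((![0, 1, 2] : Fin 3 → Fin 4) i))) (![m + 2, 1, m + 1] : Fin 3 → ℕ) hσJ hp hσpL)).colon (Ideal.span {cobordantAlgebra.s (fun i => algebraMap (MvPolynomial (Fin 4) k) (Localization.Away hh) (X ((![0, 1, 2] : Fin 3 → Fin 4) i))) (![m + 2, 1, m + 1] : Fin 3 → ℕ) ^ (m + 1)}))).map (algebraMap ↥(cobordantAlgebra (fun i => algebraMap (MvPolynomial (Fin 4) k) (Localization.Away hh) (X ((![0, 1, 2] : Fin 3 → Fin 4) i))) (![m + 2, 1, m + 1] : Fin 3 → ℕ)) (ChartRing 𝒜 (fun i => algebraMap (MvPolynomial (Fin 4) k) (Localization.Away hh) (X ((![0, 1, 2] : Fin 3 → Fin 4) i))) (![m + 2, 1, m + 1] : Fin 3 → ℕ) dbar (y j) (hy j))))) := by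
  classical
  haveI : NeZero p := ⟨(Fact.out : p.Prime).ne_zero⟩
  have hp1 : p ≠ 1 := (Fact.out : p.Prime).ne_one
  haveI : CharP (Localization.Away hh) p := qhl_charP hh hh0
  obtain ⟨r0, r1, r2, r3⟩ := qhl_rows σ h0 h1 h2 (X 2 - X 1 ^ (m + 1) * Polynomial.aeval (X 1 : MvPolynomial (Fin 4) k) wl : MvPolynomial (Fin 4) k) h3 hh hσh
  have hw0 : (![m + 2, 1, m + 1] : Fin 3 → ℕ) 0 = (![m + 2, 1, m + 1] : Fin 3 → ℕ) 1 + (m + 1) := by change m + 2 = 1 + (m + 1); ring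
  have hd₀ : dbar = (![m + 2, 1, m + 1] : Fin 3 → ℕ) 0 * n₀ := hd₀'
  have hd₁ : dbar = p * (![m + 2, 1, m + 1] : Fin 3 → ℕ) 1 * n₁ := by rw [hd₁']; change p * n₁ = p * 1 * n₁; ring
  have hd₂ : dbar = (m + 1) * p * n₂ := hd₂'
  -- the cover, kept opaque
  obtain ⟨cov, hcov⟩ : ∃ cov : Fin 3 → (Localization.Away hh), cov = ![(fun i => algebraMap (MvPolynomial (Fin 4) k) (Localization.Away hh) (X ((![0, 1, 2] : Fin 3 → Fin 4) i))) 0 ^ n₀, (∏ i : ZMod p, ((fun i => algebraMap (MvPolynomial (Fin 4) k) (Localization.Away hh) (X ((![0, 1, 2] : Fin 3 → Fin 4) i))) 1 + (i.val : (Localization.Away hh)) * (fun i => algebraMap (MvPolynomial (Fin 4) k) (Localization.Away hh) (X ((![0, 1, 2] : Fin 3 → Fin 4) i))) 0)) ^ n₁,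
      (∏ j : ZMod p, (⇑(sigmaAway σ hσh))^[j.val] (algebraMap (MvPolynomial (Fin 4) k) (Localization.Away hh) (X 2 - X 1 ^ (m + 1) * Polynomial.aeval (X 1 : MvPolynomial (Fin 4) k) wl : MvPolynomial (Fin 4) k))) ^ n₂] := ⟨_, rfl⟩
  have hcov0 : cov 0 = (fun i => algebraMap (MvPolynomial (Fin 4) k) (Localization.Away hh) (X ((![0, 1, 2] : Fin 3 → Fin 4) i))) 0 ^ n₀ := by rw [hcov]; rfl
  have hcov1 : cov 1 = (∏ i : ZMod p, ((fun i => algebraMap (MvPolynomial (Fin 4) k) (Localization.Away hh) (X ((![0, 1, 2] : Fin 3 → Fin 4) i))) 1 + (i.val : (Localization.Away hh)) * (fun i => algebraMap (MvPolynomial (Fin 4) k) (Localization.Away hh) (X ((![0, 1, 2] : Fin 3 → Fin 4) i))) 0)) ^ n₁ := by rw [hcov]; rfl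
  have hcov2 : cov 2 = (∏ j : ZMod p, (⇑(sigmaAway σ hσh))^[j.val] (algebraMap (MvPolynomial (Fin 4) k) (Localization.Away hh) (X 2 - X 1 ^ (m + 1) * Polynomial.aeval (X 1 : MvPolynomial (Fin 4) k) wl : MvPolynomial (Fin 4) k))) ^ n₂ := by rw [hcov]; rfl
  let y : Fin 3 → ↥(𝒜 0) := fun j => ⟨cov j, h𝒜 _⟩
  have hyval : ∀ j, (y j : (Localization.Away hh)) = cov j := fun _ => rfl
  have hy : ∀ j, y j ∈ (traceFiltration 𝒜 (fun i => algebraMap (MvPolynomial (Fin 4) k) (Localization.Away hh) (X ((![0, 1, 2] : Fin 3 → Fin 4) i))) (![m + 2, 1, m + 1] : Fin 3 → ℕ)).ideal (dbar) := fun j => by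
    rw [mem_traceFiltration_iff, hyval]
    refine Fin.cases ?_ (Fin.cases ?_ (Fin.cases ?_ (fun l => l.elim0))) j
    · rw [hcov0]; exact QhAbs.qha_cover_zero_mem (fun i => algebraMap (MvPolynomial (Fin 4) k) (Localization.Away hh) (X ((![0, 1, 2] : Fin 3 → Fin 4) i))) (![m + 2, 1, m + 1] : Fin 3 → ℕ) _ _ hd₀
    · change cov 1 ∈ _; rw [hcov1]; exact QhAbs.qha_cover_one_mem (fun i => algebraMap (MvPolynomial (Fin 4) k) (Localization.Away hh) (X ((![0, 1, 2] : Fin 3 → Fin 4) i))) (![m + 2, 1, m + 1] : Fin 3 → ℕ) (m + 1) hw0 (p := p) _ _ hd₁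
    · change cov 2 ∈ _; rw [hcov2]; exact QhAbs.qha_cover_two_mem (sigmaAway σ hσh) (fun i => algebraMap (MvPolynomial (Fin 4) k) (Localization.Away hh) (X ((![0, 1, 2] : Fin 3 → Fin 4) i))) (algebraMap (MvPolynomial (Fin 4) k) (Localization.Away hh) (X 2 - X 1 ^ (m + 1) * Polynomial.aeval (X 1 : MvPolynomial (Fin 4) k) wl : MvPolynomial (Fin 4) k)) (![m + 2, 1, m + 1] : Fin 3 → ℕ) (m + 1) ht hσJ (p := p) _ _ hd₂
  have hσy : ∀ j, (sigmaAway σ hσh) (y j : (Localization.Away hh)) = y j := fun j => by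
    rw [hyval]
    refine Fin.cases ?_ (Fin.cases ?_ (Fin.cases ?_ (fun l => l.elim0))) j
    · rw [hcov0]; exact QhAbs.qha_cover_zero_fixed (sigmaAway σ hσh) (fun i => algebraMap (MvPolynomial (Fin 4) k) (Localization.Away hh) (X ((![0, 1, 2] : Fin 3 → Fin 4) i))) r0 _
    · change (sigmaAway σ hσh) (cov 1) = cov 1; rw [hcov1]; exact QhAbs.qha_cover_one_fixed (sigmaAway σ hσh) (fun i => algebraMap (MvPolynomial (Fin 4) k) (Localization.Away hh) (X ((![0, 1, 2] : Fin 3 → Fin 4) i))) r0 r1 hp1 _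
    · change (sigmaAway σ hσh) (cov 2) = cov 2; rw [hcov2]; exact QhAbs.qha_cover_two_fixed (sigmaAway σ hσh) (algebraMap (MvPolynomial (Fin 4) k) (Localization.Away hh) (X 2 - X 1 ^ (m + 1) * Polynomial.aeval (X 1 : MvPolynomial (Fin 4) k) wl : MvPolynomial (Fin 4) k)) hσpL _
  have hc0 := QhAbs.qha_coverElement_zero_eq (fun i => algebraMap (MvPolynomial (Fin 4) k) (Localization.Away hh) (X ((![0, 1, 2] : Fin 3 → Fin 4) i))) (![m + 2, 1, m + 1] : Fin 3 → ℕ) mo 𝒜 (y 0) (hy 0) n₀ hd₀ (by rw [hyval, hcov0])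
  have hc1 := QhAbs.qha_coverElement_one_eq (fun i => algebraMap (MvPolynomial (Fin 4) k) (Localization.Away hh) (X ((![0, 1, 2] : Fin 3 → Fin 4) i))) (![m + 2, 1, m + 1] : Fin 3 → ℕ) (m + 1) hw0 mo 𝒜 (y 1) (hy 1) n₁ hd₁ (by rw [hyval, hcov1])
  have hc2 := QhAbs.qha_coverElement_two_eq (sigmaAway σ hσh) (fun i => algebraMap (MvPolynomial (Fin 4) k) (Localization.Away hh) (X ((![0, 1, 2] : Fin 3 → Fin 4) i))) (algebraMap (MvPolynomial (Fin 4) k) (Localization.Away hh) (X 2 - X 1 ^ (m + 1) * Polynomial.aeval (X 1 : MvPolynomial (Fin 4) k) wl : MvPolynomial (Fin 4) k)) (![m + 2, 1, m + 1] : Fin 3 → ℕ) (m + 1) ht hσJ mo 𝒜 (y 2) (hy 2) hp hσpL n₂ hd₂ (by rw [hyval, hcov2])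
  have hdvd := QhAbs.qha_tail_dvd_coverElement_two (sigmaAway σ hσh) (fun i => algebraMap (MvPolynomial (Fin 4) k) (Localization.Away hh) (X ((![0, 1, 2] : Fin 3 → Fin 4) i))) (algebraMap (MvPolynomial (Fin 4) k) (Localization.Away hh) (X 2 - X 1 ^ (m + 1) * Polynomial.aeval (X 1 : MvPolynomial (Fin 4) k) wl : MvPolynomial (Fin 4) k)) (![m + 2, 1, m + 1] : Fin 3 → ℕ) (m + 1) ht hσJ mo 𝒜 (y 2) (hy 2) hp hσpL n₂ hn₂ hd₂ (by rw [hyval, hcov2])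
  have hrad : ∀ l : Fin 3, cobordantAlgebra.u' (fun i => algebraMap (MvPolynomial (Fin 4) k) (Localization.Away hh) (X ((![0, 1, 2] : Fin 3 → Fin 4) i))) (![m + 2, 1, m + 1] : Fin 3 → ℕ) l ∈ (Ideal.span (Set.range fun j => coverElement 𝒜 (fun i => algebraMap (MvPolynomial (Fin 4) k) (Localization.Away hh) (X ((![0, 1, 2] : Fin 3 → Fin 4) i))) (![m + 2, 1, m + 1] : Fin 3 → ℕ) dbar (y j) (hy j))).radical := fun l =>
    QhAbs.qha_hrad (fun i => algebraMap (MvPolynomial (Fin 4) k) (Localization.Away hh) (X ((![0, 1, 2] : Fin 3 → Fin 4) i))) (![m + 2, 1, m + 1] : Fin 3 → ℕ) (m + 1) (fun j => coverElement 𝒜 (fun i => algebraMap (MvPolynomial (Fin 4) k) (Localization.Away hh) (X ((![0, 1, 2] : Fin 3 → Fin 4) i))) (![m + 2, 1, m + 1] : Fin 3 → ℕ) dbar (y j) (hy j)) hn₁ hc0 hc1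
      (fun j : ZMod p => ((sigmaR (sigmaAway σ hσh) (fun i => algebraMap (MvPolynomial (Fin 4) k) (Localization.Away hh) (X ((![0, 1, 2] : Fin 3 → Fin 4) i))) (![m + 2, 1, m + 1] : Fin 3 → ℕ) hσJ hp hσpL))^[j.val] (⟨_, C_mul_T_mem_cobordantAlgebra _ _ ht⟩ : ↥(cobordantAlgebra (fun i => algebraMap (MvPolynomial (Fin 4) k) (Localization.Away hh) (X ((![0, 1, 2] : Fin 3 → Fin 4) i))) (![m + 2, 1, m + 1] : Fin 3 → ℕ)))) (fun j => graphRoot_iterate_tail_sub_mem σ h0 h1 h2 m wl h3 hh hσh hp hσpL hσJ ht j.val) hc2 l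
  -- the residual ideal `𝔞 ∋ u₀′, t̂, c₂`
  have hmem0 := qhl_u'_zero_mem_residual σ h1 (![m + 2, 1, m + 1] : Fin 3 → ℕ) (m + 1) hw0 hh hσh hp hσp hσJ
  have hmemt := qhl_tail_mem_residual σ (X 2 - X 1 ^ (m + 1) * Polynomial.aeval (X 1 : MvPolynomial (Fin 4) k) wl : MvPolynomial (Fin 4) k) h3 (![m + 2, 1, m + 1] : Fin 3 → ℕ) (m + 1) hh hσh hp hσp hσJ ht
  have hmem2 : coverElement 𝒜 (fun i => algebraMap (MvPolynomial (Fin 4) k) (Localization.Away hh) (X ((![0, 1, 2] : Fin 3 → Fin 4) i))) (![m + 2, 1, m + 1] : Fin 3 → ℕ) dbar (y 2) (hy 2) ∈ ((augmentationIdeal (sigmaR (sigmaAway σ hσh) (fun i => algebraMap (MvPolynomial (Fin 4) k) (Localization.Away hh) (X ((![0, 1, 2] : Fin 3 → Fin 4) i))) (![m + 2, 1, m + 1] : Fin 3 → ℕ) hσJ hp hσpL)).colon (Ideal.span {cobordantAlgebra.s (fun i => algebraMap (MvPolynomial (Fin 4) k) (Localization.Away hh) (X ((![0, 1, 2] : Fin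 3 → Fin 4) i))) (![m + 2, 1, m + 1] : Fin 3 → ℕ) ^ (m + 1)})) := Ideal.mem_of_dvd _ hdvd hmemt
  refine ⟨y, hy, hσy, hcov0, hcov1, hcov2, hc0, hc1, hdvd, hrad, fun j => ⟨?_, ?_⟩⟩
  · exact QhAbs.qha_residualSection_zero (fun i => algebraMap (MvPolynomial (Fin 4) k) (Localization.Away hh) (X ((![0, 1, 2] : Fin 3 → Fin 4) i))) (![m + 2, 1, m + 1] : Fin 3 → ℕ) mo 𝒜 (fun _ => h𝒜 _) (y j) (hy j) n₀ hd₀ _ hmem0 hn₀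
  · exact QhAbs.qha_residualSection_of_mem (fun i => algebraMap (MvPolynomial (Fin 4) k) (Localization.Away hh) (X ((![0, 1, 2] : Fin 3 → Fin 4) i))) (![m + 2, 1, m + 1] : Fin 3 → ℕ) mo 𝒜 (fun _ => h𝒜 _) (y j) (hy j) (y 2) (hy 2) _ hmem2

end Data

end Summit.ResolutionOfSingularities.ResolutionOfSingularities.Theorems.WildQuotientResolution.S1.KillCert.QhAway

end
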